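import Summits.BirchSwinnertonDyer.BirchSwinnertonDyer.Theorems.KolyvaginRoadThreeMethod2Defs
import Mathlib.RingTheory.Coprime.Lemmas
import HarnessLib

/-!
# Route `KolyvaginRoadThree`, deciding crux `ZhangSharpFrameAtThreeHL` (item stmt-BirchSwinnertonDyer-19574):
# the ONE-PRIME STEP of the METHOD skeleton `Method2` — how the canonical space changes from level `n` to `n ∪ {q}`
# (cell `bsd-stepL`, seat `bsd-stepL-zhang3-p1` g5; `--supports stmt-BirchSwinnertonDyer-19574`, helper)

Stub A (`stub_levelRaisingAtThree`, (A1)) compares `SelQ W K c (insert q n) μ` with `SelQ W K c n μ`. By DEFINITION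
the two spaces impose the same conditions everywhere except at the places above `q`, where level `n` asks E's
KUMMER condition and level `n ∪ {q}` asks the ORDINARY condition (W. Zhang 2014, (9.3): *"the local condition from
A₂ differs from that from A₁ only at the place q₂"*). This file records that bookkeeping once, so that a prover of
(A1) only has to argue about the two local conditions AT `q` (Bertolini–Darmon Lemma 2.6 ∕ koly U1–U4 at a
unipotent-admissible prime, Gross–Parson parity lemma):

* `levelSelmerSubgroup_insert_inf_kummer_eq` — for `q ∉ n ∪ S` whose places are disjoint from those above `n ∪ S`:
  `Sel_{n∪q,S} ⊓ (Kummer above q) = Sel_{n,S} ⊓ (ordinary above q)`;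
* corollaries `mem_levelSelmerSubgroup_insert_of_ordinary` ∕ `mem_levelSelmerSubgroup_of_insert_of_kummer`: a
  level-`n` class ordinary above `q` is a level-`(n ∪ {q})` class, and a level-`(n ∪ {q})` class Kummer above `q` is
  a level-`n` class (so (A1)'s inclusion ∕ codimension bookkeeping is a statement about the two conditions AT `q`);
* `not_mem_asIdeal_of_coprime` — distinct rational primes have disjoint sets of places (Bezout), which discharges
  the disjointness hypothesis for sets of (unipotent-admissible) primes: `selQ_insert_inf_kummer_eq`.

HONEST FRAMING. Unfolding of the definitions in `KolyvaginRoadThreeMethod2Defs.lean` (p456348); no arithmetic input,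
no named fact, no `sorry`, 0 defs. PARTITION: O2@3 (B10) × A1 × crux 19574 — none (bookkeeping; T7).
[cite: WZhang2014, §9 (9.3) and Prop. 5.4] [cite: BertoliniDarmon2005, §2.3]
-/

noncomputable section

open scoped Classical

namespace Summit.BirchSwinnertonDyer.Rank1Residual.X11b.Three.Koly.Method2

open WeierstrassCurve NumberField IsDedekindDomain
  Literature.NumberTheory.EllipticCurves Literature.NumberTheory.GaloisRepresentations Module

variable (W : WeierstrassCurve ℚ) (K : Type) [Field K] [NumberField K] (c : K ≃ₐ[ℚ] K)

omit [NumberField K] in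
/-- **Coprime integers lie in no common finite place** (Bezout: `a q + b q' = 1 ∈ v` would make `v = ⊤`).
[folklore] -/
theorem not_mem_asIdeal_of_coprime {q q' : ℕ} (h : Nat.Coprime q q') (v : HeightOneSpectrum (𝓞 K))
    (hq : (q : 𝓞 K) ∈ v.asIdeal) : (q' : 𝓞 K) ∉ v.asIdeal := by
  intro hq'
  have hcop : IsCoprime (q : ℤ) (q' : ℤ) := Nat.isCoprime_iff_coprime.mpr h
  obtain ⟨a, b, hab⟩ := hcop
  have h1 : (1 : 𝓞 K) ∈ v.asIdeal := by
    have : ((a * q + b * q' : ℤ) : 𝓞 K) = 1 := by rw [hab, Int.cast_one]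
    rw [← this]
    push_cast
    exact v.asIdeal.add_mem (v.asIdeal.mul_mem_left _ hq) (v.asIdeal.mul_mem_left _ hq')
  exact v.isPrime.ne_top ((Ideal.eq_top_iff_one _).mpr h1)

/-- **The one-prime step, as an identity of subgroups.** Let `q ∉ S` be a natural number none of whose places lies
above a member of `n ∪ S`. Then the level-`(n ∪ {q})` space cut back by E's Kummer condition above `q` equals the
level-`n` space cut by the ordinary condition above `q`: the two levels impose identical conditions away from `q`.
[cite: WZhang2014, §9 (9.3)] -/
theorem levelSelmerSubgroup_insert_inf_kummer_eq (n : Finset ℕ) (S : Set ℕ) (μ : Bool) {q : ℕ} (hqn : q ∉ n)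
    (hqS : q ∉ S)
    (hdisj : ∀ v : HeightOneSpectrum (𝓞 K), (q : 𝓞 K) ∈ v.asIdeal → ∀ q' ∈ (n : Set ℕ) ∪ S, (q' : 𝓞 K) ∉ v.asIdeal) :
    levelSelmerSubgroup W K c (insert q n) S μ ⊓
        (⨅ (v : HeightOneSpectrum (𝓞 K)) (_ : (q : 𝓞 K) ∈ v.asIdeal),
          selmerLocalKer (W.baseChange K) (v.adicCompletion K) ((3 ^ 1 : ℕ) : ℤ)) =
      levelSelmerSubgroup W K c n S μ ⊓
        (⨅ (v : HeightOneSpectrum (𝓞 K)) (_ : (q : 𝓞 K) ∈ v.asIdeal),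
          (W.baseChange K).ordinaryLocalKer (v.adicCompletion K) ((3 ^ 1 : ℕ) : ℤ)) := by
  ext x
  simp only [levelSelmerSubgroup, AddSubgroup.mem_inf, AddSubgroup.mem_iInf, Finset.coe_insert]
  constructor
  · rintro ⟨⟨heig, hinf, hfin, hord⟩, hkq⟩
    refine ⟨⟨heig, hinf, fun v hv ↦ ?_, fun q' hq' v hv ↦ ?_⟩, fun v hv ↦ ?_⟩
    · -- Kummer at the places above no member of n ∪ S
      by_cases hvq : (q : 𝓞 K) ∈ v.asIdeal
      · exact hkq v hvq
      · refine hfin v fun q' hq'' ↦ ?_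
        rcases hq'' with hq'' | hq''
        · rcases Set.mem_insert_iff.mp hq'' with rfl | hq''
          · exact hvq
          · exact hv q' (Or.inl hq'')
        · exact hv q' (Or.inr hq'')
    · -- ordinary at n \ S
      exact hord q' ⟨Finset.mem_insert_of_mem hq'.1, hq'.2⟩ v hv
    · -- ordinary above q
      exact hord q ⟨Finset.mem_insert_self q n, hqS⟩ v hv
  · rintro ⟨⟨heig, hinf, hfin, hord⟩, hoq⟩
    refine ⟨⟨heig, hinf, fun v hv ↦ ?_, fun q' hq' v hv ↦ ?_⟩, fun v hv ↦ ?_⟩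
    · -- Kummer at the places above no member of (n ∪ {q}) ∪ S: a fortiori none of n ∪ S
      refine hfin v fun q' hq'' ↦ hv q' ?_
      rcases hq'' with hq'' | hq''
      · exact Or.inl (Set.mem_insert_of_mem _ hq'')
      · exact Or.inr hq''
    · -- ordinary at (n ∪ {q}) \ S
      rcases Finset.mem_insert.mp hq'.1 with rfl | hmem
      · exact hoq v hv
      · exact hord q' ⟨hmem, hq'.2⟩ v hv
    · -- Kummer above q: such a place lies above no member of n ∪ S
      exact hfin v fun q' hq' ↦ hdisj v hv q' hq'

/-- **Going up is controlled by the ordinary condition at `q`**: a level-`n` class that is ordinary above `q` is a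
level-`(n ∪ {q})` class. [cite: WZhang2014, §9 (9.3)] -/
theorem mem_levelSelmerSubgroup_insert_of_ordinary (n : Finset ℕ) (S : Set ℕ) (μ : Bool) {q : ℕ} (hqn : q ∉ n)
    (hqS : q ∉ S)
    (hdisj : ∀ v : HeightOneSpectrum (𝓞 K), (q : 𝓞 K) ∈ v.asIdeal → ∀ q' ∈ (n : Set ℕ) ∪ S, (q' : 𝓞 K) ∉ v.asIdeal)
    {x : V3 W K} (hx : x ∈ levelSelmerSubgroup W K c n S μ)
    (hord : ∀ v : HeightOneSpectrum (𝓞 K), (q : 𝓞 K) ∈ v.asIdeal →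
      x ∈ (W.baseChange K).ordinaryLocalKer (v.adicCompletion K) ((3 ^ 1 : ℕ) : ℤ)) :
    x ∈ levelSelmerSubgroup W K c (insert q n) S μ := by
  have h : x ∈ levelSelmerSubgroup W K c n S μ ⊓
      (⨅ (v : HeightOneSpectrum (𝓞 K)) (_ : (q : 𝓞 K) ∈ v.asIdeal),
        (W.baseChange K).ordinaryLocalKer (v.adicCompletion K) ((3 ^ 1 : ℕ) : ℤ)) :=
    AddSubgroup.mem_inf.mpr ⟨hx, AddSubgroup.mem_iInf.mpr fun v ↦ AddSubgroup.mem_iInf.mpr fun hv ↦ hord v hv⟩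
  rw [← levelSelmerSubgroup_insert_inf_kummer_eq W K c n S μ hqn hqS hdisj] at h
  exact (AddSubgroup.mem_inf.mp h).1

/-- **Going down is controlled by the Kummer condition at `q`**: a level-`(n ∪ {q})` class that is Kummer above `q`
is a level-`n` class (Zhang Prop. 5.4: the new Selmer group meets the old one in the kernel of `loc_q`).
[cite: WZhang2014, Prop. 5.4] -/
theorem mem_levelSelmerSubgroup_of_insert_of_kummer (n : Finset ℕ) (S : Set ℕ) (μ : Bool) {q : ℕ} (hqn : q ∉ n)
    (hqS : q ∉ S)
    (hdisj : ∀ v : HeightOneSpectrum (𝓞 K), (q : 𝓞 K) ∈ v.asIdeal → ∀ q' ∈ (n : Set ℕ) ∪ S, (q' : 𝓞 K) ∉ v.asIdeal)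
    {x : V3 W K} (hx : x ∈ levelSelmerSubgroup W K c (insert q n) S μ)
    (hkum : ∀ v : HeightOneSpectrum (𝓞 K), (q : 𝓞 K) ∈ v.asIdeal →
      x ∈ selmerLocalKer (W.baseChange K) (v.adicCompletion K) ((3 ^ 1 : ℕ) : ℤ)) :
    x ∈ levelSelmerSubgroup W K c n S μ := by
  have h : x ∈ levelSelmerSubgroup W K c (insert q n) S μ ⊓
      (⨅ (v : HeightOneSpectrum (𝓞 K)) (_ : (q : 𝓞 K) ∈ v.asIdeal),
        selmerLocalKer (W.baseChange K) (v.adicCompletion K) ((3 ^ 1 : ℕ) : ℤ)) :=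
    AddSubgroup.mem_inf.mpr ⟨hx, AddSubgroup.mem_iInf.mpr fun v ↦ AddSubgroup.mem_iInf.mpr fun hv ↦ hkum v hv⟩
  rw [levelSelmerSubgroup_insert_inf_kummer_eq W K c n S μ hqn hqS hdisj] at h
  exact (AddSubgroup.mem_inf.mp h).1

variable [W.IsGloballyMinimal]

/-- For a finite set `n` of unipotent-admissible primes and a unipotent-admissible `q ∉ n`, the places above `q`
lie above no member of `n` (distinct primes are coprime). [folklore] -/
theorem disjoint_places_of_uAdmissible (n : Finset {q // IsUAdmissiblePrime W K q})
    (S : Set {q // IsUAdmissiblePrime W K q}) (q : {q // IsUAdmissiblePrime W K q}) (hqn : q ∉ n) (hqS : q ∉ S) :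
    ∀ v : HeightOneSpectrum (𝓞 K), ((q : ℕ) : 𝓞 K) ∈ v.asIdeal →
      ∀ q' ∈ ((n.image Subtype.val : Finset ℕ) : Set ℕ) ∪ Subtype.val '' S, (q' : 𝓞 K) ∉ v.asIdeal := by
  intro v hv q' hq'
  have hne : (q : ℕ) ≠ q' := by
    rintro heq
    rcases hq' with hq' | hq'
    · rw [Finset.mem_coe, Finset.mem_image] at hq'
      obtain ⟨a, ha, ha'⟩ := hq'
      exact hqn (by rwa [show a = q from Subtype.ext (ha'.trans heq.symm)] at ha)
    · obtain ⟨a, ha, ha'⟩ := hq'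
      exact hqS (by rwa [show a = q from Subtype.ext (ha'.trans heq.symm)] at ha)
  have hq'prime : q'.Prime := by
    rcases hq' with hq' | hq'
    · rw [Finset.mem_coe, Finset.mem_image] at hq'
      obtain ⟨a, -, rfl⟩ := hq'
      exact a.2.1
    · obtain ⟨a, -, rfl⟩ := hq'
      exact a.2.1
  exact not_mem_asIdeal_of_coprime K ((Nat.coprime_primes q.2.1 hq'prime).mpr hne) v hv

/-- **The one-prime step for the canonical spaces `SelQ`** (as `ZMod 3`-subspaces): for a unipotent-admissible
`q ∉ n`, `SelQ (insert q n) μ ⊓ (Kummer above q) = SelQ n μ ⊓ (ordinary above q)`. [cite: WZhang2014, §9 (9.3)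
and Prop. 5.4] -/
theorem selQ_insert_inf_kummer_eq [Module (ZMod 3) (V3 W K)] (n : Finset {q // IsUAdmissiblePrime W K q})
    (q : {q // IsUAdmissiblePrime W K q}) (hqn : q ∉ n) (μ : Bool) :
    SelQ W K c (insert q n) μ ⊓ AddSubgroup.toZModSubmodule 3
        (⨅ (v : HeightOneSpectrum (𝓞 K)) (_ : ((q : ℕ) : 𝓞 K) ∈ v.asIdeal),
          selmerLocalKer (W.baseChange K) (v.adicCompletion K) ((3 ^ 1 : ℕ) : ℤ)) =
      SelQ W K c n μ ⊓ AddSubgroup.toZModSubmodule 3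
        (⨅ (v : HeightOneSpectrum (𝓞 K)) (_ : ((q : ℕ) : 𝓞 K) ∈ v.asIdeal),
          (W.baseChange K).ordinaryLocalKer (v.adicCompletion K) ((3 ^ 1 : ℕ) : ℤ)) := by
  unfold SelQ
  rw [← map_inf, ← map_inf, Finset.image_insert]
  congr 1
  refine levelSelmerSubgroup_insert_inf_kummer_eq W K c _ _ μ ?_ (Set.notMem_empty _) ?_
  · rw [Finset.mem_image]
    rintro ⟨a, ha, ha'⟩
    exact hqn (by rwa [show a = q from Subtype.ext ha'] at ha)
  · simpa only [Set.image_empty] using disjoint_places_of_uAdmissible W K n ∅ q hqn (Set.notMem_empty _)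

end Summit.BirchSwinnertonDyer.Rank1Residual.X11b.Three.Koly.Method2

end
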